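import Literature.NumberTheory.ComplexMultiplication.TateHalfTransfer
import HarnessLib

/-!
# Tate's half transfer over an orbit is a transfer: `F_j(σ) = σ_j⁻¹ V(σ) σ_j` — the group theory of Milne's Prop. 4.9
# (Milne, *The fundamental theorem of complex multiplication*, arXiv:0705.3446, §4.2, proof of Proposition 4.9)

Topic `NumberTheory/ComplexMultiplication`; namespace `Literature.NumberTheory.ComplexMultiplication`.  Lane
`lit-hodgefound` (Track 2, Layer A3 skeleton seat `skel-3`, row A3-G46 FILE 1 of 4: the GROUP THEORY of Milne's proof of
Proposition 4.9 «`N_Φ(a) ∈ f_Φ(σ)`»; FILE 2 `…/ReflexNormIdelesOrbits` is the orbit decomposition «`N_Φ(a) = ∏ b_j`» of the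
reflex norm on idèles, FILE 3 `…/TateHalfTransferReflexNorm` is «`art_E(N_Φ(a)) = F_Φ(σ)`», FILE 4
`…/TaniyamaElementReflexNorm` is Proposition 4.9).  Sequel of row A3-G45 FILE 1 `…/TateHalfTransfer` (Tate's half transfer
`F_Φ`, the group theory).  One definition with body (`orbitTransferHom`) and theorems, all proved; no named fact, no
instance (D-0026, net debt 0).

## The print, verbatim

J. S. Milne, *The fundamental theorem of complex multiplication*, arXiv:0705.3446 [Milne2007FundamentalCM], §4.2, proof
of PROPOSITION 4.9 (held `paper:arxiv-0705.3446` p0020 L62–L115):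

> «Partition `Φ` into orbits, `Φ = ∪_j Φ_j`, for the left action of `Aut(ℂ/E*)`. […] where `σ_j` is any element of
> `Aut(ℂ)` such that `σ_j|E ∈ Φ_j` and `L_j = (σ_j⁻¹E*)E`. […] Let `F_j(σ) = ∏_{φ∈Φ_j} w_{σφ}⁻¹ σ w_φ (mod Aut(ℂ/E^ab))`.
> […] Consider `{t_φ | t_φ = w_φ σ_j⁻¹, φ ∈ Φ_j}`; this is a set of coset representatives for `σ_j Aut(ℂ/L_j) σ_j⁻¹` in
> `Aut(ℂ/E*)`, and so `F_j(σ) = ∏_{φ∈Φ_j} σ_j⁻¹ t_{σφ}⁻¹ σ t_φ σ_j = σ_j⁻¹ V(σ) σ_j mod Aut(ℂ/E^ab)`.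
> Thus `art_E(N_Φ(a)) = ∏ art_E(b_j) = ∏ F_j(σ) = F_Φ(σ)`.»

Here `V : Aut(ℂ/E*) → (σ_j Aut(ℂ/L_j) σ_j⁻¹)^ab` is the transfer (Verlagerung) to the finite-index subgroup
`σ_j Aut(ℂ/L_j) σ_j⁻¹ = Aut(ℂ/E*) ∩ σ_j Aut(ℂ/E) σ_j⁻¹`, the stabiliser in `Aut(ℂ/E*)` of the embedding `σ_j|E ∈ Φ_j`.

## What is formalised (the group theory only; the setting of `…/TateHalfTransfer`)

A group `G` acting on `X` (in print `Aut(ℂ)` or `Γ_ℚ` on `Hom(E, ℂ) = Γ_ℚ ⧸ Γ_E`), a base point `x₀` with stabiliser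
`H ≤ G` given extensionally by `hH : g ∈ H ↔ g • x₀ = x₀` (`= Aut(ℂ/E)`), a homomorphism `ϕ : H →* A` to a commutative
group (`H → Gal(E^ab/E)`), a section `w : X → G`, `w x • x₀ = x` (Tate's `{w_ρ}`), and the factors
`halfTransferFactor hH hw σ x = w(σx)⁻¹ σ w(x) ∈ H` of Tate's product `F_Φ^w(σ) = ∏_{x∈Φ} ϕ(w(σx)⁻¹ σ w(x))`
(`halfTransferWith`).  NEW here: a subgroup `S ≤ G` (in print `Aut(ℂ/E*)`, or `Γ_k` for a field `k ⊇ E*`) and an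
`S`-orbit `O = S • q ⊆ X` (`Φ_j`) through a point `q = g • x₀` (`σ_j|E`, `g = σ_j`).

* §1 **Independence of the section on a `σ`-stable finite set** (`finprod_mem_halfTransferFactor_eq_of_smul_eq`): if
  `σ • O = O` then `∏_{x∈O} ϕ(w(σx)⁻¹σw(x))` is the same for any two sections `w`, `w'` (the change is
  `∏_{x∈O} ϕ(h_x) / ∏_{x∈σO} ϕ(h_x)`, `h_x = w(x)⁻¹w'(x) ∈ H` — the proof of Lemma 4.4 without the symmetry, which is
  not needed once `σ` stabilises the set); hence `halfTransferWith ϕ hH hw Φ σ` does not depend on `w` for `σ` in the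
  stabiliser of `Φ` (`halfTransferWith_eq_of_smul_eq`), and equals the section-free `halfTransfer` there
  (`halfTransfer_eq_halfTransferWith_of_smul_eq`).
* §2 **The character `ϕ ∘ Inn(g⁻¹)` on the stabiliser** (`orbitTransferHom ϕ hH S hg : stabilizer S q →* A`,
  `t ↦ ϕ(g⁻¹ t g)`; `g⁻¹ t g ∈ H` because `t` fixes `q = g • x₀`) — in print the map
  `σ_j Aut(ℂ/L_j) σ_j⁻¹ → Gal(E^ab/E)`, `u ↦ σ_j⁻¹ u σ_j mod Aut(ℂ/E^ab)` («`ad σ_j⁻¹`» followed by restriction).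
* §3 **`F_j(σ) = σ_j⁻¹ V(σ) σ_j`** (`finprod_mem_orbit_halfTransferFactor_eq_transfer`): for `σ ∈ S`,
  **`∏_{x ∈ S•q} ϕ(w(σx)⁻¹ σ w(x)) = Ver(σ)`**, the transfer `MonoidHom.transfer (orbitTransferHom ϕ hH S hg) σ` of
  Mathlib from `S` to the finite-index subgroup `stabilizer S q` for the character of §2 — by §1 one may compute with the
  section `w(t • q) = t g` built from representatives `t ∈ S` («`t_φ = w_φ σ_j⁻¹` … a set of coset representatives»),
  for which every factor is `g⁻¹ (t_{σx}⁻¹ σ t_x) g`, and `∏ ϕ_g(t_{σx}⁻¹ σ t_x)` over `S•q ≃ S ⧸ stabilizer S q` is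
  FILE `…/TateHalfTransfer`'s `finprod_halfTransferFactor_eq_transfer` (Neukirch's formula for `Ver`).
* §4 For `X` finite (the case `X = Hom(E, ℂ)`): the stabiliser has finite index (`finiteIndex_stabilizer_of_finite`),
  the form `finprod_mem_orbit_eq_transfer` with that instance supplied, and **`F_Φ^w(σ) = ∏_j F_j(σ)`**
  (`halfTransferWith_eq_prod_transfer`): over a decomposition `Φ = ⊔_i S•q_i` into `S`-orbits,
  `halfTransferWith ϕ hH hw Φ σ = ∏_i transfer (orbitTransferHom ϕ hH S (hg i)) σ` for `σ ∈ S` («`∏ F_j(σ) = F_Φ(σ)`»).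

NOT HERE: the number theory (FILES 2–4: `S = Γ_k`, the fields `σ_jL_j`, the Artin maps).

## References

* J. S. Milne, *The fundamental theorem of complex multiplication*, arXiv:0705.3446 (2007), §4.2, Prop. 4.9 (proof).
  [Milne2007FundamentalCM]
* J. Neukirch, *Algebraic Number Theory*, Springer 1999, Ch. IV §5 p. 271 (the transfer `Ver`). [NeukirchANT1999]

## Provenance

Lane `lit-hodgefound`, seat `literature-prover-lit-hodgefound-skel-3-g30-0` (row A3-G46, FILE 1 of 4).
-/

noncomputable section

open scoped Pointwise

namespace Literature.NumberTheory.ComplexMultiplication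

open HalfTransfer

variable {G : Type*} [Group G] {X : Type*} [MulAction G X] {A : Type*} [CommGroup A]

/-! ### §1. On a `σ`-stable finite set the product does not depend on the section -/

section Independence

variable {H : Subgroup G} {x₀ : X} (ϕ : H →* A) (hH : ∀ g : G, g ∈ H ↔ g • x₀ = x₀)

/-- The quotient `h(x) = w(x)⁻¹ w'(x) ∈ H` of two sections («`w'_ρ = w_ρ h_ρ`, `h_ρ ∈ Aut(ℂ/iE)`»; a copy of the private
`sectionQuot` of `…/TateHalfTransfer`). [cite: Milne2007FundamentalCM, §4.2 Lemma 4.4 (proof)] -/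
private def sectionQuot' {w w' : X → G} (hw : ∀ x, w x • x₀ = x) (hw' : ∀ x, w' x • x₀ = x) (x : X) : H :=
  ⟨(w x)⁻¹ * w' x, (hH _).2 (by rw [mul_smul, hw', inv_smul_eq_iff, hw])⟩

/-- `factor'(σ, x) = h(σx)⁻¹ · factor(σ, x) · h(x)`. [cite: Milne2007FundamentalCM, §4.2 Lemma 4.4 (proof)] -/
private theorem halfTransferFactor_eq_sectionQuot' {w w' : X → G} (hw : ∀ x, w x • x₀ = x)
    (hw' : ∀ x, w' x • x₀ = x) (σ : G) (x : X) :
    halfTransferFactor hH hw' σ x =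
      (sectionQuot' hH hw hw' (σ • x))⁻¹ * halfTransferFactor hH hw σ x * sectionQuot' hH hw hw' x :=
  Subtype.ext (by
    simp only [coe_halfTransferFactor, sectionQuot', Subgroup.coe_mul, Subgroup.coe_inv, mul_inv_rev, inv_inv]
    group)

/-- **On a `σ`-stable finite set `O` the product `∏_{x∈O} ϕ(w(σx)⁻¹ σ w(x))` does not depend on the section `w`**: the
change of section multiplies it by `∏_{x∈O} ϕ(h_x) / ∏_{x∈O} ϕ(h_{σx})` and `x ↦ σx` permutes `O` — the computation of
Lemma 4.4 («`F_Φ(σ)` is changed by `∏ h_{σφ}⁻¹ h_φ` … the inside product is `1` because … `∏_{φ∈Φ} h_φ = ∏_{φ∈Φ} h_{σφ}`»)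
for a set stabilised by `σ` itself, as the orbits `Φ_j` of Prop. 4.9 are for `σ ∈ Aut(ℂ/E*)`.
[cite: Milne2007FundamentalCM, §4.2 Lemma 4.4 (proof), Prop. 4.9 (proof)] -/
theorem finprod_mem_halfTransferFactor_eq_of_smul_eq {O : Set X} (hO : O.Finite) {σ : G} (hσ : σ • O = O)
    {w w' : X → G} (hw : ∀ x, w x • x₀ = x) (hw' : ∀ x, w' x • x₀ = x) :
    ∏ᶠ x ∈ O, ϕ (halfTransferFactor hH hw σ x) = ∏ᶠ x ∈ O, ϕ (halfTransferFactor hH hw' σ x) := by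
  let q : X → A := fun x => ϕ (sectionQuot' hH hw hw' x)
  -- `F' = F · (∏_{x∈O} q x) / (∏_{x∈O} q (σ x))`
  have h1 : ∏ᶠ x ∈ O, ϕ (halfTransferFactor hH hw' σ x) =
      (∏ᶠ x ∈ O, ϕ (halfTransferFactor hH hw σ x)) * ((∏ᶠ x ∈ O, q x) / ∏ᶠ x ∈ O, q (σ • x)) := by
    rw [div_eq_mul_inv, ← finprod_mem_inv_distrib _ hO, ← finprod_mem_mul_distrib hO, ← finprod_mem_mul_distrib hO]
    refine finprod_mem_congr rfl fun x _ => ?_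
    rw [halfTransferFactor_eq_sectionQuot' hH hw hw' σ x, map_mul, map_mul, map_inv]
    simp only [q]
    rw [mul_comm (ϕ _)⁻¹, mul_assoc, mul_comm (ϕ _)⁻¹]
  -- `∏_{x∈O} q (σ x) = ∏_{x ∈ σO} q x = ∏_{x∈O} q x`
  have h2 : ∏ᶠ x ∈ O, q (σ • x) = ∏ᶠ x ∈ O, q x := by
    rw [← finprod_mem_image (MulAction.injective σ).injOn, Set.image_smul, hσ]
  rw [h1, h2, div_self', mul_one]

/-- **`F_Φ^w(σ)` does not depend on `w` for `σ` in the stabiliser of `Φ`** (`Φ` finite, `σΦ = Φ`; no symmetry of the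
sections is needed) — the form of Lemma 4.4 used on `Aut(ℂ/E*) = {σ | σΦ = Φ}`.
[cite: Milne2007FundamentalCM, §4.2 Lemma 4.4, Prop. 4.9 (proof)] -/
theorem halfTransferWith_eq_of_smul_eq {Φ : Set X} (hΦ : Φ.Finite) {σ : G} (hσ : σ • Φ = Φ) {w w' : X → G}
    (hw : ∀ x, w x • x₀ = x) (hw' : ∀ x, w' x • x₀ = x) :
    halfTransferWith ϕ hH hw Φ σ = halfTransferWith ϕ hH hw' Φ σ := by
  rw [halfTransferWith_def, halfTransferWith_def]
  exact finprod_mem_halfTransferFactor_eq_of_smul_eq ϕ hH hΦ hσ hw hw'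

/-- For `σ` in the stabiliser of a CM type `Φ` the section-free `halfTransfer` (computed with a symmetric system) is
computed by ANY section. [cite: Milne2007FundamentalCM, §4.2 Lemma 4.4, Prop. 4.9 (proof)] -/
theorem halfTransfer_eq_halfTransferWith_of_smul_eq [Finite X] {ι : G} {Φ : Set X} (hΦ : IsCMTypeWith ι Φ)
    (hex : ∃ w₀ : X → G, IsSymmSection ι x₀ w₀) {σ : G} (hσ : σ • Φ = Φ) {w : X → G} (hw : ∀ x, w x • x₀ = x) :
    halfTransfer ϕ x₀ hH ι Φ σ = halfTransferWith ϕ hH hw Φ σ := by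
  obtain ⟨w₀, hw₀⟩ := hex
  rw [halfTransfer_eq_halfTransferWith ϕ hH hΦ hw₀ σ]
  exact halfTransferWith_eq_of_smul_eq ϕ hH (Set.toFinite Φ) hσ hw₀.smul_base hw

end Independence

/-! ### §2. The character `t ↦ ϕ(g⁻¹ t g)` on the stabiliser of `q = g • x₀` in `S` -/

section OrbitHom

variable {H : Subgroup G} {x₀ : X}

/-- If `t ∈ S` fixes `q = g • x₀` then `g⁻¹ t g` fixes `x₀`, i.e. lies in `H` («`σ_j Aut(ℂ/L_j) σ_j⁻¹` in `Aut(ℂ/E*)`»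
conjugated back by `σ_j⁻¹` lands in `Aut(ℂ/L_j) ⊆ Aut(ℂ/E)`). [cite: Milne2007FundamentalCM, §4.2 Prop. 4.9 (proof)] -/
theorem conj_mem_of_mem_stabilizer (hH : ∀ g : G, g ∈ H ↔ g • x₀ = x₀) (S : Subgroup G) {q : X} {g : G}
    (hg : g • x₀ = q) {t : S} (ht : t ∈ MulAction.stabilizer S q) : g⁻¹ * (t : G) * g ∈ H :=
  (hH _).2 (by
    rw [mul_smul, mul_smul, hg, ← Subgroup.smul_def, MulAction.mem_stabilizer_iff.1 ht, ← hg, inv_smul_smul])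

/-- **The character `ϕ ∘ Inn(g⁻¹)` on `Stab_S(q)`**, `t ↦ ϕ(g⁻¹ t g)`, for `q = g • x₀` — in print the map
`σ_j Aut(ℂ/L_j) σ_j⁻¹ → Gal(E^ab/E)`, `u ↦ σ_j⁻¹ u σ_j mod Aut(ℂ/E^ab)` (the composite «`ad σ_j⁻¹`» then «restriction» of
the bottom row of Milne's diagram). [cite: Milne2007FundamentalCM, §4.2 Prop. 4.9 (proof: «σ_j⁻¹V(σ)σ_j»)] -/
def orbitTransferHom (ϕ : H →* A) (hH : ∀ g : G, g ∈ H ↔ g • x₀ = x₀) (S : Subgroup G) {q : X} {g : G}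
    (hg : g • x₀ = q) : MulAction.stabilizer S q →* A where
  toFun t := ϕ ⟨g⁻¹ * ((t : S) : G) * g, conj_mem_of_mem_stabilizer hH S hg t.2⟩
  map_one' := by
    rw [← map_one ϕ]
    exact congrArg ϕ (Subtype.ext (by simp))
  map_mul' t t' := by
    rw [← map_mul]
    exact congrArg ϕ (Subtype.ext (by
      simp only [Subgroup.coe_mul]
      group))

variable (ϕ : H →* A) (hH : ∀ g : G, g ∈ H ↔ g • x₀ = x₀) (S : Subgroup G) {q : X} {g : G} (hg : g • x₀ = q)

/-- Unfolding: `orbitTransferHom ϕ hH S hg t = ϕ ⟨g⁻¹ t g, _⟩`. [cite: Milne2007FundamentalCM, §4.2 Prop. 4.9 (proof)] -/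
theorem orbitTransferHom_apply (t : MulAction.stabilizer S q) :
    orbitTransferHom ϕ hH S hg t = ϕ ⟨g⁻¹ * ((t : S) : G) * g, conj_mem_of_mem_stabilizer hH S hg t.2⟩ := rfl

/-- The value at `t` depends only on the element `g⁻¹ t g ∈ H`: if `g⁻¹ t g = h` then `orbitTransferHom … t = ϕ h`.
[cite: Milne2007FundamentalCM, §4.2 Prop. 4.9 (proof)] -/
theorem orbitTransferHom_eq_of_eq (t : MulAction.stabilizer S q) {h : H} (hh : g⁻¹ * ((t : S) : G) * g = h) :
    orbitTransferHom ϕ hH S hg t = ϕ h := by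
  rw [orbitTransferHom_apply]
  exact congrArg ϕ (Subtype.ext hh)

end OrbitHom

/-! ### §3. The product over an `S`-orbit is the transfer: `F_j(σ) = σ_j⁻¹ V(σ) σ_j` -/

section Orbit

variable {H : Subgroup G} {x₀ : X} (ϕ : H →* A) (hH : ∀ g : G, g ∈ H ↔ g • x₀ = x₀) (S : Subgroup G)
  {q : X} {g : G} (hg : g • x₀ = q)

omit hH in
/-- An `S`-orbit is stable under every `σ ∈ S` (as a subset of `X` moved by `σ ∈ G`).
[cite: Milne2007FundamentalCM, §4.2 Prop. 4.9 (proof: «Φ Aut(ℂ/E) … is stable under the left action of Aut(ℂ/E*)»)] -/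
theorem smul_orbit_eq (σ : S) : (σ : G) • MulAction.orbit S q = MulAction.orbit S q := by
  conv_rhs => rw [← MulAction.smul_orbit σ q]
  rfl

/-- **`F_j(σ) = σ_j⁻¹ V(σ) σ_j`.**  For `σ ∈ S`, any section `w` and the `S`-orbit `S • q` of `q = g • x₀` whose stabiliser
`Stab_S(q)` has finite index in `S`:
`∏_{x ∈ S•q} ϕ(w(σx)⁻¹ σ w(x)) = Ver_{S → Stab_S(q)}(σ)` pushed to `A` by the character `t ↦ ϕ(g⁻¹ t g)` — Mathlib's
`MonoidHom.transfer (orbitTransferHom ϕ hH S hg) σ`.  PROOF as printed: by §1 compute with the section `w(t•q) = t·g`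
built from representatives `t_x ∈ S`, `t_x • q = x` («`t_φ = w_φ σ_j⁻¹` … a set of coset representatives for
`σ_jAut(ℂ/L_j)σ_j⁻¹` in `Aut(ℂ/E*)`»); then every factor is `g⁻¹ (t_{σx}⁻¹ σ t_x) g` («`σ_j⁻¹ t_{σφ}⁻¹ σ t_φ σ_j`») and
`∏_x ϕ_g(t_{σx}⁻¹ σ t_x)` over `S•q ≃ S ⧸ Stab_S(q)` is the transfer (`finprod_halfTransferFactor_eq_transfer` of
`…/TateHalfTransfer`, Neukirch's formula `Ver(σ) = ∏_ρ σ_ρ`, `σρ = ρ'σ_ρ`).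
[cite: Milne2007FundamentalCM, §4.2 Prop. 4.9 (proof: «F_j(σ) = ∏ σ_j⁻¹ t_{σφ}⁻¹ σ t_φ σ_j = σ_j⁻¹V(σ)σ_j»)]
[cite: NeukirchANT1999, Ch. IV §5 p. 271 (definition of Ver)] -/
theorem finprod_mem_orbit_halfTransferFactor_eq_transfer [(MulAction.stabilizer S q).FiniteIndex]
    {w : X → G} (hw : ∀ x, w x • x₀ = x) (σ : S) :
    ∏ᶠ x ∈ MulAction.orbit S q, ϕ (halfTransferFactor hH hw σ x) =
      MonoidHom.transfer (orbitTransferHom ϕ hH S hg) σ := by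
  classical
  haveI : Finite (S ⧸ MulAction.stabilizer S q) := Subgroup.finite_quotient_of_finiteIndex
  haveI : Finite (MulAction.orbit S q) := Finite.of_equiv _ (MulAction.orbitEquivQuotientStabilizer S q).symm
  have hOfin : (MulAction.orbit S q).Finite := Set.toFinite _
  -- representatives `t_x ∈ S` with `t_x • q = x` for `x` in the orbit
  have hex : ∀ x : X, ∃ t : S, x ∈ MulAction.orbit S q → t • q = x := fun x => by
    by_cases hx : x ∈ MulAction.orbit S q
    · obtain ⟨t, ht⟩ := MulAction.mem_orbit_iff.1 hx
      exact ⟨t, fun _ => ht⟩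
    · exact ⟨1, fun h => (hx h).elim⟩
  choose t ht using hex
  -- the adapted section `w₁(x) = t_x g` on the orbit
  let w₁ : X → G := fun x => if x ∈ MulAction.orbit S q then ((t x : S) : G) * g else w x
  have hw₁ : ∀ x, w₁ x • x₀ = x := fun x => by
    by_cases hx : x ∈ MulAction.orbit S q
    · simp only [w₁, if_pos hx, mul_smul, hg, ← Subgroup.smul_def, ht x hx]
    · simp only [w₁, if_neg hx, hw]
  rw [finprod_mem_halfTransferFactor_eq_of_smul_eq ϕ hH hOfin (smul_orbit_eq S σ) hw hw₁]
  -- each factor is `g⁻¹ (t_{σx}⁻¹ σ t_x) g` with `t_{σx}⁻¹ σ t_x ∈ Stab_S(q)`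
  have hmem : ∀ x ∈ MulAction.orbit S q, (t ((σ : G) • x))⁻¹ * σ * t x ∈ MulAction.stabilizer S q := fun x hx => by
    have hσx : (σ : G) • x ∈ MulAction.orbit S q := by
      rw [← Subgroup.smul_def]; exact MulAction.mem_orbit_of_mem_orbit σ hx
    rw [MulAction.mem_stabilizer_iff, mul_smul, mul_smul, ht x hx, inv_smul_eq_iff, ht _ hσx, Subgroup.smul_def]
  have hfac : ∀ x (hx : x ∈ MulAction.orbit S q), ϕ (halfTransferFactor hH hw₁ σ x) =
      orbitTransferHom ϕ hH S hg ⟨(t ((σ : G) • x))⁻¹ * σ * t x, hmem x hx⟩ := fun x hx => by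
    have hσx : (σ : G) • x ∈ MulAction.orbit S q := by
      rw [← Subgroup.smul_def]; exact MulAction.mem_orbit_of_mem_orbit σ hx
    rw [orbitTransferHom_apply]
    refine congrArg ϕ (Subtype.ext ?_)
    simp only [coe_halfTransferFactor, w₁, if_pos hx, if_pos hσx, Subgroup.coe_mul, Subgroup.coe_inv, mul_inv_rev]
    group
  -- the section `c ↦ t_{c•q}` of `S ⧸ Stab_S(q)` and FILE 1's transfer formula
  let e := MulAction.orbitEquivQuotientStabilizer S q
  let w' : S ⧸ MulAction.stabilizer S q → S := fun c => t ((e.symm c : MulAction.orbit S q) : X)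
  have he : ∀ s : S, ((e.symm (s : S ⧸ MulAction.stabilizer S q) : MulAction.orbit S q) : X) = s • q := fun s =>
    MulAction.orbitEquivQuotientStabilizer_symm_apply S q s
  have hw' : ∀ c : S ⧸ MulAction.stabilizer S q,
      w' c • ((1 : S) : S ⧸ MulAction.stabilizer S q) = c := fun c => by
    induction c using QuotientGroup.induction_on with
    | H s =>
      rw [MulAction.Quotient.smul_mk, smul_eq_mul, mul_one, QuotientGroup.eq, MulAction.mem_stabilizer_iff,
        mul_smul, inv_smul_eq_iff]
      simp only [w', he]
      exact (ht _ (MulAction.mem_orbit _ _)).symm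
  let F : X → A := fun x => ϕ (halfTransferFactor hH hw₁ σ x)
  rw [← finprod_halfTransferFactor_eq_transfer (orbitTransferHom ϕ hH S hg) hw' σ,
    ← finprod_set_coe_eq_finprod_mem (MulAction.orbit S q) (f := F),
    show (∏ᶠ x : MulAction.orbit S q, F x) = ∏ᶠ c : S ⧸ MulAction.stabilizer S q, F (e.symm c) from
      (finprod_comp_equiv e.symm).symm]
  refine finprod_congr fun c => ?_
  induction c using QuotientGroup.induction_on with
  | H s =>
    simp only [F]
    rw [hfac _ (e.symm _).2]
    refine congrArg (orbitTransferHom ϕ hH S hg) (Subtype.ext ?_)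
    have hσs : σ • ((s : S) : S ⧸ MulAction.stabilizer S q) = ((σ * s : S) : S ⧸ MulAction.stabilizer S q) := by
      rw [MulAction.Quotient.smul_mk, smul_eq_mul]
    simp only [coe_halfTransferFactor, w', hσs, he, mul_smul, Subgroup.smul_def]

end Orbit

/-! ### §4. `X` finite: the stabiliser has finite index; the section-free form -/

section FiniteX

variable {H : Subgroup G} {x₀ : X} (ϕ : H →* A) (hH : ∀ g : G, g ∈ H ↔ g • x₀ = x₀) (S : Subgroup G)
  {q : X} {g : G} (hg : g • x₀ = q)

omit hH in
/-- For `X` finite every stabiliser `Stab_S(q)` has finite index in `S` (index = size of the orbit) — in print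
`[Aut(ℂ/E*) : σ_jAut(ℂ/L_j)σ_j⁻¹] = |Φ_j|`. [cite: Milne2007FundamentalCM, §4.2 Prop. 4.9 (proof)] -/
theorem finiteIndex_stabilizer_of_finite [Finite X] (q : X) : (MulAction.stabilizer S q).FiniteIndex := by
  haveI : Finite (S ⧸ MulAction.stabilizer S q) :=
    Finite.of_equiv _ (MulAction.orbitEquivQuotientStabilizer S q)
  exact Subgroup.finiteIndex_of_finite_quotient

/-- **The orbit formula for the section-free half transfer's factors**, `X` finite: for `σ ∈ S` and ANY section `w`,
`∏_{x ∈ S•q} ϕ(w(σx)⁻¹σw(x)) = transfer (orbitTransferHom ϕ hH S hg) σ` with the finite-index instance supplied.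
[cite: Milne2007FundamentalCM, §4.2 Prop. 4.9 (proof: «F_j(σ) = σ_j⁻¹V(σ)σ_j»)] -/
theorem finprod_mem_orbit_eq_transfer [Finite X] {w : X → G} (hw : ∀ x, w x • x₀ = x) (σ : S) :
    ∏ᶠ x ∈ MulAction.orbit S q, ϕ (halfTransferFactor hH hw σ x) =
      @MonoidHom.transfer S _ (MulAction.stabilizer S q) A _ (orbitTransferHom ϕ hH S hg)
        (finiteIndex_stabilizer_of_finite S q) σ := by
  haveI := finiteIndex_stabilizer_of_finite S q
  exact finprod_mem_orbit_halfTransferFactor_eq_transfer ϕ hH S hg hw σ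

/-- **`F_Φ^w(σ) = ∏_j F_j(σ)` over a decomposition of `Φ` into `S`-orbits**: if the finite `Φ` is the disjoint union of
the orbits `S • q_i` (`i ∈ ι` finite, `q_i = g_i • x₀`), then for `σ ∈ S`
`halfTransferWith ϕ hH hw Φ σ = ∏_i transfer (orbitTransferHom ϕ hH S (hg i)) σ` — «`∏ F_j(σ) = F_Φ(σ)`» with each
`F_j(σ) = σ_j⁻¹V(σ)σ_j`. [cite: Milne2007FundamentalCM, §4.2 Prop. 4.9 (proof: «Thus art_E(N_Φ(a)) = ∏ art_E(b_j) = ∏ F_j(σ) = F_Φ(σ)»)] -/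
theorem halfTransferWith_eq_prod_transfer [Finite X] {ι : Type*} [Fintype ι] {qs : ι → X} {gs : ι → G}
    (hgs : ∀ i, gs i • x₀ = qs i) {Φ : Set X} (hΦ : Φ = ⋃ i, MulAction.orbit S (qs i))
    (hdisj : Pairwise fun i i' => Disjoint (MulAction.orbit S (qs i)) (MulAction.orbit S (qs i')))
    {w : X → G} (hw : ∀ x, w x • x₀ = x) (σ : S) :
    halfTransferWith ϕ hH hw Φ σ =
      ∏ i, @MonoidHom.transfer S _ (MulAction.stabilizer S (qs i)) A _ (orbitTransferHom ϕ hH S (hgs i))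
        (finiteIndex_stabilizer_of_finite S (qs i)) σ := by
  rw [halfTransferWith_def, hΦ, finprod_mem_iUnion hdisj (fun i => Set.toFinite _), finprod_eq_prod_of_fintype]
  exact Finset.prod_congr rfl fun i _ => finprod_mem_orbit_eq_transfer ϕ hH S (hgs i) hw σ

end FiniteX

end Literature.NumberTheory.ComplexMultiplication

end
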